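import Literature.AlgebraicGeometry.Resolution.SeparablyClosedDensity
import Literature.AlgebraicGeometry.Resolution.GeneralizedStabilityLemma55VT
import Literature.AlgebraicGeometry.Resolution.HenselizedFunctionFieldsReduction
import HarnessLib

/-!
# Density of `K(x)` in `K'(x)` for a dense subfield `K ≤ K'`

Topic: `Literature/AlgebraicGeometry/Resolution` (valued function fields). PROVED valuation
theory, continuing `SeparablyClosedDensity.lean`, for the discharge of the named facts
`Kuhlmann2010SeparablyDefectlessRational_sepClosed` and
`Kuhlmann2010SeparablyDefectlessRationalRT_sepClosed` (F.-V. Kuhlmann, *Elimination of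
ramification I*, Trans. AMS 362 (2010) = arXiv:1003.5678, Thm. 1.1, "separably defectless"
clause, §5 p. 20: "Then the completion `F^c` of `(F,v)` contains the completion `K^c` of
`(K,v)` … We consider the subfield `F.K^c ⊂ F^c`"): the elementary fact that a rational
function field `K(x)` is dense in `K'(x)` as soon as `K` is dense in `K'` and `vK'` is coinitial
in `vK'(x)` (the rôle of the hypothesis "`vK` is cofinal in `vF`" of Thm. 1.1).

* `exists_mem_closure_valuation_aeval_sub_lt` — polynomials `f(x)`, `f ∈ K'[X]`, are
  approximable from `K(x)` (indeed from `K[x]`) to within every value of `K'(x)^×`: constants by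
  density of `K` in `K'`, then sums and products with `x` (ultrametric inequality).
* `isDenseIn_closure_insert` — **`K(x)` is dense in `K'(x)`**: quotients `f(x)/g(x)` are
  approximated by `f̃(x)/g̃(x)` with `v(g - g̃) < v(g)` (so `v(g̃) = v(g)`) and
  `f/g - f̃/g̃ = (f(g̃ - g) + g(f - f̃))/(g g̃)`.
* `coinitial_closure_insert_of_isResidueTranscendental` — for `x` residue-transcendental over
  `K'` the coinitiality hypothesis holds (`vK'(x) = vK'`, Kuhlmann 2010, Lemma 2.5);
  `coinitial_closure_insert_of_isValueTranscendentalOver` — for `x` value-transcendental over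
  `K'` it follows from `IsValueCofinal V K K(x)` for any `K ≤ K'` (`vK'(x) = vK' ⊕ ℤ vx`).

Everything is standard ([folklore]) and PROVED; no new definitions or named facts.

## Sources

* F.-V. Kuhlmann, Trans. AMS 362 (2010) = arXiv:1003.5678: Thm. 1.1, Lemma 2.5, §5 (p. 20).
  [Kuhlmann2010]

## Rendering notes

Subfields of one valued field `(Ω, V)`; `K(x) = Subfield.closure (K ∪ {x})` (equal to
`IntermediateField.adjoin K {x}`, `mem_adjoin_subfield_iff`); density is `IsDenseIn`
(`SeparablyDefectlessDenseDescent.lean`).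
-/

noncomputable section

open IsLocalRing Polynomial

namespace Literature.AlgebraicGeometry.Resolution

universe u

variable {Ω : Type u} [Field Ω] (V : ValuationSubring Ω)

/-! ### Polynomials and quotients -/

section Generic

variable {K K' : Subfield Ω} (x : Ω)

/-- Elements of `K'[x]` lie in `K'(x)`. [folklore] -/
theorem aeval_mem_closure_insert (f : Polynomial K') :
    aeval x f ∈ Subfield.closure ((K' : Set Ω) ∪ {x}) := by
  rw [← mem_adjoin_subfield_iff]
  exact IntermediateField.algebra_adjoin_le_adjoin K' _ (Polynomial.aeval_mem_adjoin_singleton K' x)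

/-- **Polynomials are approximable.** If `K` is dense in `K'` and `vK'` is coinitial in
`vK'(x)`, then for every `f ∈ K'[X]` and `c ∈ K'(x)^×` there is `z ∈ K(x)` with
`v(f(x) - z) < v(c)`. [folklore] -/
theorem exists_mem_closure_valuation_aeval_sub_lt (hd : IsDenseIn V K K')
    (hco : ∀ e ∈ Subfield.closure ((K' : Set Ω) ∪ {x}), e ≠ 0 →
      ∃ d ∈ K', d ≠ 0 ∧ V.valuation d ≤ V.valuation e)
    (f : Polynomial K') {c : Ω} (hc : c ∈ Subfield.closure ((K' : Set Ω) ∪ {x})) (hc0 : c ≠ 0) :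
    ∃ z ∈ Subfield.closure ((K : Set Ω) ∪ {x}), V.valuation (aeval x f - z) < V.valuation c := by
  induction f using Polynomial.induction_on generalizing c with
  | C a =>
    obtain ⟨d, hdK', hd0, hdc⟩ := hco c hc hc0
    obtain ⟨z, hzK, hz⟩ := hd a a.2 d hdK' hd0
    refine ⟨z, Subfield.subset_closure (Or.inl hzK), ?_⟩
    rw [aeval_C]
    exact lt_of_lt_of_le hz hdc
  | add f g hf hg =>
    obtain ⟨z₁, hz₁, h₁⟩ := hf hc hc0
    obtain ⟨z₂, hz₂, h₂⟩ := hg hc hc0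
    refine ⟨z₁ + z₂, add_mem hz₁ hz₂, ?_⟩
    rw [map_add, add_sub_add_comm]
    exact lt_of_le_of_lt (Valuation.map_add _ _ _) (max_lt h₁ h₂)
  | monomial n a h =>
    by_cases hx0 : x = 0
    · refine ⟨0, zero_mem _, ?_⟩
      rw [sub_zero, map_mul, map_pow, aeval_X, hx0, zero_pow (Nat.succ_ne_zero n), mul_zero,
        map_zero]
      exact (Valuation.pos_iff _).mpr hc0
    · have hxE' : x ∈ Subfield.closure ((K' : Set Ω) ∪ {x}) :=
        Subfield.subset_closure (Or.inr rfl)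
      have hcx : c * x⁻¹ ∈ Subfield.closure ((K' : Set Ω) ∪ {x}) :=
        mul_mem hc (inv_mem hxE')
      have hcx0 : c * x⁻¹ ≠ 0 := mul_ne_zero hc0 (inv_ne_zero hx0)
      obtain ⟨z, hz, hlt⟩ := h hcx hcx0
      refine ⟨z * x, mul_mem hz (Subfield.subset_closure (Or.inr rfl)), ?_⟩
      have hvx : 0 < V.valuation x := (Valuation.pos_iff _).mpr hx0
      rw [pow_succ, ← mul_assoc, map_mul (aeval x), aeval_X, ← sub_mul, map_mul]
      calc V.valuation (aeval x (C a * X ^ n) - z) * V.valuation x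
          < V.valuation (c * x⁻¹) * V.valuation x := mul_lt_mul_of_pos_right hlt hvx
        _ = V.valuation c := by
          rw [map_mul, map_inv₀, inv_mul_cancel_right₀ hvx.ne']

/-- **`K(x)` is dense in `K'(x)`** when `K ≤ K'` is dense in `K'` and `vK'` is coinitial in
`vK'(x)`: every `y = f(x)/g(x) ∈ K'(x)` is approximable from `K(x)` to within every value of
`K'(x)^×`. [folklore] -/
theorem isDenseIn_closure_insert (hd : IsDenseIn V K K')
    (hco : ∀ e ∈ Subfield.closure ((K' : Set Ω) ∪ {x}), e ≠ 0 →
      ∃ d ∈ K', d ≠ 0 ∧ V.valuation d ≤ V.valuation e) :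
    IsDenseIn V (Subfield.closure ((K : Set Ω) ∪ {x})) (Subfield.closure ((K' : Set Ω) ∪ {x})) := by
  intro y hy c hc hc0
  have hvc : 0 < V.valuation c := (Valuation.pos_iff _).mpr hc0
  have triv : ∃ z ∈ Subfield.closure ((K : Set Ω) ∪ {x}), V.valuation ((0 : Ω) - z) < V.valuation c :=
    ⟨0, zero_mem _, by rwa [sub_zero, map_zero]⟩
  have hy' : y ∈ IntermediateField.adjoin K' ({x} : Set Ω) := (mem_adjoin_subfield_iff K' {x} y).mpr hy
  obtain ⟨f, g, rfl⟩ := (IntermediateField.mem_adjoin_simple_iff K' y).mp hy'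
  set F : Ω := aeval x f with hFdef
  set G : Ω := aeval x g with hGdef
  by_cases hG : G = 0
  · rw [hG, div_zero]; exact triv
  by_cases hF : F = 0
  · rw [hF, zero_div]; exact triv
  have hvF : 0 < V.valuation F := (Valuation.pos_iff _).mpr hF
  have hvG : 0 < V.valuation G := (Valuation.pos_iff _).mpr hG
  have hFE' : F ∈ Subfield.closure ((K' : Set Ω) ∪ {x}) := aeval_mem_closure_insert x f
  have hGE' : G ∈ Subfield.closure ((K' : Set Ω) ∪ {x}) := aeval_mem_closure_insert x g
  -- approximate `F` to within `v(cG)`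
  obtain ⟨F', hF'E, hF'⟩ := exists_mem_closure_valuation_aeval_sub_lt V x hd hco f
    (mul_mem hc hGE') (mul_ne_zero hc0 hG)
  -- approximate `G` to within `min (v G) (v (c G² / F))`
  obtain ⟨r, hrE', hr0, hrG, hr2⟩ : ∃ r ∈ Subfield.closure ((K' : Set Ω) ∪ {x}), r ≠ 0 ∧
      V.valuation r ≤ V.valuation G ∧ V.valuation r ≤ V.valuation (c * G ^ 2 / F) := by
    have hm : c * G ^ 2 / F ∈ Subfield.closure ((K' : Set Ω) ∪ {x}) :=
      div_mem (mul_mem hc (pow_mem hGE' 2)) hFE'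
    have hm0 : c * G ^ 2 / F ≠ 0 := div_ne_zero (mul_ne_zero hc0 (pow_ne_zero 2 hG)) hF
    by_cases h : V.valuation G ≤ V.valuation (c * G ^ 2 / F)
    · exact ⟨G, hGE', hG, le_rfl, h⟩
    · exact ⟨c * G ^ 2 / F, hm, hm0, (not_le.mp h).le, le_rfl⟩
  obtain ⟨G', hG'E, hG'⟩ := exists_mem_closure_valuation_aeval_sub_lt V x hd hco g hrE' hr0
  have hGG' : V.valuation (G' - G) < V.valuation G := by
    rw [Valuation.map_sub_swap]; exact lt_of_lt_of_le hG' hrG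
  have hvG' : V.valuation G' = V.valuation G := Valuation.map_eq_of_sub_lt _ hGG'
  have hG'0 : G' ≠ 0 := fun h0 => by rw [h0, map_zero] at hvG'; exact hvG.ne' hvG'.symm |>.elim
  refine ⟨F' / G', div_mem hF'E hG'E, ?_⟩
  rw [div_sub_div _ _ hG hG'0]
  have hN : F * G' - G * F' = F * (G' - G) + G * (F - F') := by ring
  rw [hN, map_div₀, map_mul, div_lt_iff₀ (mul_pos hvG ((Valuation.pos_iff _).mpr hG'0)), hvG']
  refine lt_of_le_of_lt (Valuation.map_add _ _ _) (max_lt ?_ ?_)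
  · -- `v F * v (G' - G) < v c * (v G * v G)`
    rw [map_mul]
    have h2 : V.valuation (G' - G) < V.valuation (c * G ^ 2 / F) := by
      rw [Valuation.map_sub_swap]; exact lt_of_lt_of_le hG' hr2
    calc V.valuation F * V.valuation (G' - G)
        < V.valuation F * V.valuation (c * G ^ 2 / F) := mul_lt_mul_of_pos_left h2 hvF
      _ = V.valuation c * (V.valuation G * V.valuation G) := by
        rw [map_div₀, map_mul, map_pow, mul_div_cancel₀ _ hvF.ne', sq]
  · -- `v G * v (F - F') < v c * (v G * v G)`
    rw [map_mul]
    calc V.valuation G * V.valuation (F - F')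
        < V.valuation G * V.valuation (c * G) := mul_lt_mul_of_pos_left hF' hvG
      _ = V.valuation c * (V.valuation G * V.valuation G) := by
        rw [map_mul]; simp only [mul_left_comm]

end Generic

/-! ### Coinitiality of `vK'` in `vK'(x)` -/

section Coinitial

variable {V}

/-- For `x` residue-transcendental over `K'`, `vK'(x) = vK'` (Kuhlmann 2010, Lemma 2.5), so
`vK'` is coinitial in `vK'(x)`. [cite: Kuhlmann2010, Lemma 2.5] -/
theorem coinitial_closure_insert_of_isResidueTranscendental {K' : Subfield Ω} {x : Ω}
    (hx : IsResidueTranscendental V K' x) :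
    ∀ e ∈ Subfield.closure ((K' : Set Ω) ∪ {x}), e ≠ 0 →
      ∃ d ∈ K', d ≠ 0 ∧ V.valuation d ≤ V.valuation e := by
  intro e he he0
  have he' : e ∈ (IntermediateField.adjoin K' ({x} : Set Ω)).toSubfield :=
    (mem_adjoin_subfield_iff K' {x} e).mpr he
  obtain ⟨b, hbK', hb⟩ := exists_valuation_eq_of_mem_adjoin_residueTranscendental V hx he' he0
  have hb0 : b ≠ 0 := fun h0 => by
    rw [h0, map_zero] at hb
    exact he0 ((Valuation.zero_iff _).mp hb)
  exact ⟨b, hbK', hb0, hb.symm.le⟩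

/-- For `x` value-transcendental over `K'` and `vK` coinitial in `vK(x)` for some `K ≤ K'`
(`IsValueCofinal V K K(x)`), `vK'` is coinitial in `vK'(x)`: a non-zero element of `K'(x)` has
value `v(a) v(x)^m` with `a ∈ K'^×`, `m ∈ ℤ` (Kuhlmann 2010, Lemma 2.5), and `v(x^m) ≥ v(d)` for
some `d ∈ K^×`. [cite: Kuhlmann2010, Lemma 2.5] -/
theorem coinitial_closure_insert_of_isValueTranscendentalOver {K K' : Subfield Ω} (hKK' : K ≤ K')
    {x : Ω} (hx : IsValueTranscendentalOver V K' x)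
    (hcof : IsValueCofinal V K (Subfield.closure ((K : Set Ω) ∪ {x}))) :
    ∀ e ∈ Subfield.closure ((K' : Set Ω) ∪ {x}), e ≠ 0 →
      ∃ d ∈ K', d ≠ 0 ∧ V.valuation d ≤ V.valuation e := by
  intro e he he0
  have he' : e ∈ (IntermediateField.adjoin K' ({x} : Set Ω)).toSubfield :=
    (mem_adjoin_subfield_iff K' {x} e).mpr he
  obtain ⟨a, haK', m, hm⟩ := exists_valuation_eq_of_mem_adjoin hx he' he0
  have hx0 : x ≠ 0 := hx.ne_zero
  have ha0 : a ≠ 0 := fun h0 => by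
    rw [h0, map_zero, zero_mul] at hm
    exact he0 ((Valuation.zero_iff _).mp hm)
  -- `x^m ∈ K(x)^×`, so `v(x^m) ≥ v(d)` for some `d ∈ K^×`
  have hxE : x ∈ Subfield.closure ((K : Set Ω) ∪ {x}) := Subfield.subset_closure (Or.inr rfl)
  have hxm : x ^ m ∈ Subfield.closure ((K : Set Ω) ∪ {x}) := zpow_mem hxE m
  obtain ⟨d, hdK, hd0, hd⟩ := hcof (x ^ m) hxm (zpow_ne_zero m hx0)
  refine ⟨a * d, mul_mem haK' (hKK' hdK), mul_ne_zero ha0 hd0, ?_⟩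
  rw [map_mul, hm, ← map_zpow₀]
  exact mul_le_mul' le_rfl hd

end Coinitial

end Literature.AlgebraicGeometry.Resolution

end
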